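import Mathlib
import Summits.ValiantsHypothesis.ValiantsHypothesis.Theorems.ValuativeGCTValuativeFlipSlidingWindows

/-!
# Per-stratum rank bound, Right-multiplied strata (crux `ValuativeGCT.ValuativeFlip`, stub `stub_fourRowPencilRank`)

P4-SIMPLE, R side, of the cyclic-tridiagonal architecture for hypothesis `H` of
`fourRowPencilRank_of_pencilCertificate` (`Cruxes/ValuativeFlip/AxisK9G1a2CyclicTridiagonal.md` §5b).
Field `K`, `n = e + k + 1`, `2 ≤ k`, injective `α γ : ZMod n → K`.  The bottoms of the
Right-multiplied generators of string length `e` of the tangent space of the cyclic tridiagonal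
pencil `m_r = y₀ - α_r y₁`, `m'_r = m_{r+1}`, `l_r = y₂ - γ_r y₃` are the `4n` products
`srGen q o t = P_{q+2o} · y_{2+t} · R_q` (`P_q = swW α 0 1 e q`, `R_q = swW γ 2 3 k (q+e+1)`,
`o t : Fin 2`).  **`sr_finrank_span_ge`: they span `≥ 4n - 2(k+2)` dimensions.**
Proof: span = range of `Fintype.linearCombination`; embed its kernel into `Fin (k+2) × Fin 2 → K`:
substituting `y₂ ↦ γ_v, y₃ ↦ 1` (`srEv v`) turns a relation `c` into `Σ_q w_q(v) • P_q = 0` with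
`w_q(v) = srW c q v = 0` unless `q ∈ [v-e, v+2]`; record `w_{v+1}(v), w_{v+2}(v)` for `k + 2`
values `v`; if they vanish, all `w_q(v)` do (`sw_coeff_eq_zero_of_sum_eq_zero_of_top_two`), so the
univariate `srPoly c q` (degree `≤ k+1`, value `w_q(v)` at `γ_v`) has `k+2` roots, is zero, and its
four coefficients vanish (evaluate at `γ_{q-1}, γ_{q-2}`). [this crux; new]
-/

set_option linter.dupNamespace false

namespace Summit.ValiantsHypothesis.ValiantsHypothesis.Theorems.ValuativeFlip

open MvPolynomial
open scoped BigOperators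

noncomputable section

/-- The Right multiplier `y_{2+t}`: `X 2` for `t = 0`, `X 3` for `t = 1`. [this crux] -/
def srMul {K : Type*} [Field K] (t : Fin 2) : MvPolynomial (Fin 4) K := if t = 0 then X 2 else X 3

/-- The `4n` Right-multiplied stratum generators `P_{q+2o} · y_{2+t} · R_q`. [this crux] -/
def srGen {K : Type*} [Field K] {n : ℕ} (α γ : ZMod n → K) (e k : ℕ)
    (i : ZMod n × Fin 2 × Fin 2) : MvPolynomial (Fin 4) K :=
  swW α 0 1 e (i.1 + 2 * ((i.2.1 : ℕ) : ZMod n)) * srMul i.2.2 * swW γ 2 3 k (i.1 + ((e + 1 : ℕ) : ZMod n))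

/-- The substitution `y₂ ↦ γ_v`, `y₃ ↦ 1` (Left variables untouched). [this crux] -/
def srEv {K : Type*} [Field K] {n : ℕ} (γ : ZMod n → K) (v : ZMod n) :
    MvPolynomial (Fin 4) K →ₐ[K] MvPolynomial (Fin 4) K :=
  aeval fun i : Fin 4 => if i = 2 then C (γ v) else if i = 3 then 1 else X i

/-- Value of the multiplier `y_{2+t}` under `srEv v`: `γ_v` or `1`. [this crux] -/
def srMulVal {K : Type*} [Field K] {n : ℕ} (γ : ZMod n → K) (t : Fin 2) (v : ZMod n) : K :=
  if t = 0 then γ v else 1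

/-- Value of the complementary window `R_q = ∏_{s<k} (y₂ - γ_{q+e+1+s} y₃)` at `(γ_v, 1)`.
[this crux] -/
def srRVal {K : Type*} [Field K] {n : ℕ} (γ : ZMod n → K) (e k : ℕ) (q v : ZMod n) : K :=
  ∏ s ∈ Finset.range k, (γ v - γ (q + ((e + 1 : ℕ) : ZMod n) + s))

/-- The coefficient `w_q(v)` of `P_q` after the substitution `srEv v` in the combination with
weights `c`: the cw generators at `q` and the ccw generators at `q - 2` contribute. [this crux] -/
def srW {K : Type*} [Field K] {n : ℕ} (γ : ZMod n → K) (e k : ℕ)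
    (c : ZMod n × Fin 2 × Fin 2 → K) (q v : ZMod n) : K :=
  (∑ t : Fin 2, c (q, 0, t) * srMulVal γ t v) * srRVal γ e k q v +
    (∑ t : Fin 2, c (q - 2, 1, t) * srMulVal γ t v) * srRVal γ e k (q - 2) v

/-- The univariate polynomial `W_q(z) = λ_q(z) R_q(z) + λ'_{q-2}(z) R_{q-2}(z)` (dehomogenised at
`y₃ = 1`), whose value at `γ_v` is `srW c q v`. [this crux] -/
def srPoly {K : Type*} [Field K] {n : ℕ} (γ : ZMod n → K) (e k : ℕ)
    (c : ZMod n × Fin 2 × Fin 2 → K) (q : ZMod n) : Polynomial K :=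
  (Polynomial.C (c (q, 0, 0)) * Polynomial.X + Polynomial.C (c (q, 0, 1))) *
      ∏ s ∈ Finset.range k, (Polynomial.X - Polynomial.C (γ (q + ((e + 1 : ℕ) : ZMod n) + s))) +
    (Polynomial.C (c (q - 2, 1, 0)) * Polynomial.X + Polynomial.C (c (q - 2, 1, 1))) *
      ∏ s ∈ Finset.range k, (Polynomial.X - Polynomial.C (γ (q - 2 + ((e + 1 : ℕ) : ZMod n) + s)))

section lemmas

variable {K : Type*} [Field K] {n : ℕ}

/-- `srEv v` fixes the Left windows `P_q`. [this crux] -/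
theorem srEv_swW_left (α γ : ZMod n → K) (v : ZMod n) (e : ℕ) (q : ZMod n) :
    srEv γ v (swW α 0 1 e q) = swW α 0 1 e q := by
  unfold srEv swW; rw [map_prod]
  refine Finset.prod_congr rfl fun s _ => ?_
  simp

/-- `srEv v` sends the Right window `R_q` to the constant `srRVal`. [this crux] -/
theorem srEv_swW_right (γ : ZMod n → K) (v : ZMod n) (e k : ℕ) (q : ZMod n) :
    srEv γ v (swW γ 2 3 k (q + ((e + 1 : ℕ) : ZMod n))) = MvPolynomial.C (srRVal γ e k q v) := by
  unfold srEv swW srRVal; rw [map_prod, map_prod]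
  refine Finset.prod_congr rfl fun s _ => ?_
  simp

/-- `srEv v` sends the multiplier `y_{2+t}` to the constant `srMulVal`. [this crux] -/
theorem srEv_srMul (γ : ZMod n → K) (v : ZMod n) (t : Fin 2) :
    srEv γ v (srMul t) = MvPolynomial.C (srMulVal γ t v) := by
  unfold srEv srMul srMulVal
  fin_cases t <;> simp

/-- `srEv v` of a generator: `P_{q+2o}` times a constant. [this crux] -/
theorem srEv_srGen (α γ : ZMod n → K) (e k : ℕ) (v : ZMod n) (i : ZMod n × Fin 2 × Fin 2) :
    srEv γ v (srGen α γ e k i) =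
      MvPolynomial.C (srMulVal γ i.2.2 v * srRVal γ e k i.1 v) *
        swW α 0 1 e (i.1 + 2 * ((i.2.1 : ℕ) : ZMod n)) := by
  unfold srGen
  rw [map_mul, map_mul, srEv_swW_left, srEv_srMul, srEv_swW_right, map_mul]
  ring

/-- **The substituted relation, regrouped by Left window**:
`srEv v (Σ_i c i • srGen i) = Σ_q srW c q v • P_q`. [this crux] -/
theorem srEv_linearCombination [NeZero n] (α γ : ZMod n → K) (e k : ℕ) (v : ZMod n)
    (c : ZMod n × Fin 2 × Fin 2 → K) :
    srEv γ v (Fintype.linearCombination K (srGen α γ e k) c) =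
      ∑ q : ZMod n, srW γ e k c q v • swW α 0 1 e q := by
  rw [Fintype.linearCombination_apply, map_sum]
  simp_rw [map_smul, srEv_srGen]
  rw [Fintype.sum_prod_type]
  -- abbreviations for the two scalar weights attached to `q`
  set a : ZMod n → K := fun q => (∑ t : Fin 2, c (q, 0, t) * srMulVal γ t v) * srRVal γ e k q v
    with ha
  set b : ZMod n → K := fun q => (∑ t : Fin 2, c (q, 1, t) * srMulVal γ t v) * srRVal γ e k q v
    with hb
  trans ∑ q : ZMod n, (a q • swW α 0 1 e q + b q • swW α 0 1 e (q + 2))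
  · refine Finset.sum_congr rfl fun q _ => ?_
    simp only [Fintype.sum_prod_type, Fin.sum_univ_two, ha, hb, Fin.val_zero, Fin.val_one,
      Nat.cast_zero, Nat.cast_one, mul_zero, add_zero, mul_one, smul_eq_C_mul, map_add, map_mul]
    ring
  rw [Finset.sum_add_distrib]
  have h2 : ∑ q : ZMod n, b q • swW α (0 : Fin 4) 1 e (q + 2) =
      ∑ q : ZMod n, b (q - 2) • swW α (0 : Fin 4) 1 e q :=
    Fintype.sum_equiv (Equiv.addRight (2 : ZMod n)) _ _ fun q => by
      simp only [Equiv.coe_addRight, add_sub_cancel_right]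
  rw [h2, ← Finset.sum_add_distrib]
  refine Finset.sum_congr rfl fun q _ => ?_
  rw [← add_smul]
  rfl

/-- `srW` is additive in the weights. [this crux] -/
theorem srW_add (γ : ZMod n → K) (e k : ℕ) (c d : ZMod n × Fin 2 × Fin 2 → K) (q v : ZMod n) :
    srW γ e k (c + d) q v = srW γ e k c q v + srW γ e k d q v := by
  simp only [srW, Pi.add_apply, Fin.sum_univ_two]
  ring

/-- `srW` is homogeneous in the weights. [this crux] -/
theorem srW_smul (γ : ZMod n → K) (e k : ℕ) (r : K) (c : ZMod n × Fin 2 × Fin 2 → K)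
    (q v : ZMod n) : srW γ e k (r • c) q v = r * srW γ e k c q v := by
  simp only [srW, Pi.smul_apply, smul_eq_mul, Fin.sum_univ_two]
  ring

/-- Index bookkeeping: every `q : ZMod n` is `v - e + t` for a unique `t < n`. [this crux] -/
theorem zmod_exists_offset [NeZero n] (v q : ZMod n) (e : ℕ) :
    ∃ t : ℕ, t < n ∧ q = v - (e : ZMod n) + t := by
  refine ⟨(q - (v - (e : ZMod n))).val, ZMod.val_lt _, ?_⟩
  rw [ZMod.natCast_zmod_val]; ring

/-- **Support of the coefficients**: `srW c q v = 0` unless `q = v - e + t` with `t ≤ e + 2`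
(otherwise `v` is a root of both `R_q` and `R_{q-2}`).  Needs `n = e + k + 1`. [this crux] -/
theorem srW_support [NeZero n] (γ : ZMod n → K) {e k : ℕ} (hn : n = e + k + 1)
    (c : ZMod n × Fin 2 × Fin 2 → K) (v q : ZMod n) (hq : srW γ e k c q v ≠ 0) :
    ∃ t : ℕ, t ≤ e + 2 ∧ q = v - (e : ZMod n) + t := by
  obtain ⟨t, htn, rfl⟩ := zmod_exists_offset v q e
  refine ⟨t, ?_, rfl⟩
  by_contra hgt
  rw [not_le] at hgt
  apply hq
  unfold srW
  have h1 : srRVal γ e k (v - (e : ZMod n) + t) v = 0 := by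
    unfold srRVal
    apply Finset.prod_eq_zero (i := n - 1 - t) (Finset.mem_range.mpr (by omega))
    rw [sub_eq_zero]; congr 1
    have hc1 : ((n - 1 - t : ℕ) : ZMod n) = -1 - (t : ZMod n) := by
      rw [Nat.cast_sub (by omega), Nat.cast_sub (by omega), Nat.cast_one, ZMod.natCast_self]
      ring
    rw [hc1]
    push_cast
    ring
  have h2 : srRVal γ e k (v - (e : ZMod n) + t - 2) v = 0 := by
    unfold srRVal
    apply Finset.prod_eq_zero (i := n + 1 - t) (Finset.mem_range.mpr (by omega))
    rw [sub_eq_zero]; congr 1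
    have hc2 : ((n + 1 - t : ℕ) : ZMod n) = 1 - (t : ZMod n) := by
      rw [Nat.cast_sub (by omega), Nat.cast_add, Nat.cast_one, ZMod.natCast_self]
      ring
    rw [hc2]
    push_cast
    ring
  rw [h1, h2, mul_zero, mul_zero, add_zero]

/-- `srPoly c q` evaluated at `γ_v` is `srW c q v`. [this crux] -/
theorem eval_srPoly (γ : ZMod n → K) (e k : ℕ) (c : ZMod n × Fin 2 × Fin 2 → K)
    (q v : ZMod n) : (srPoly γ e k c q).eval (γ v) = srW γ e k c q v := by
  unfold srPoly srW srRVal srMulVal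
  simp [Polynomial.eval_prod, Fin.sum_univ_two]

/-- `natDegree (srPoly c q) ≤ k + 1`. [this crux] -/
theorem natDegree_srPoly_le (γ : ZMod n → K) (e k : ℕ) (c : ZMod n × Fin 2 × Fin 2 → K)
    (q : ZMod n) : (srPoly γ e k c q).natDegree ≤ k + 1 := by
  unfold srPoly
  have hlin : ∀ a b : K, (Polynomial.C a * Polynomial.X + Polynomial.C b).natDegree ≤ 1 := by
    intro a b
    refine (Polynomial.natDegree_add_le _ _).trans (max_le ?_ ?_)
    · exact (Polynomial.natDegree_C_mul_le _ _).trans Polynomial.natDegree_X_le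
    · exact (Polynomial.natDegree_C _).le.trans zero_le_one
  have hprod : ∀ f : ℕ → K, (∏ s ∈ Finset.range k, (Polynomial.X - Polynomial.C (f s))).natDegree ≤ k := by
    intro f
    refine (Polynomial.natDegree_prod_le _ _).trans ?_
    refine (Finset.sum_le_sum fun s _ => (Polynomial.natDegree_X_sub_C (f s)).le).trans ?_
    simp
  refine (Polynomial.natDegree_add_le _ _).trans (max_le ?_ ?_)
  · refine (Polynomial.natDegree_mul_le).trans ?_
    have h1 := hlin (c (q, 0, 0)) (c (q, 0, 1))
    have h2 : (∏ s ∈ Finset.range k, (Polynomial.X -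
        Polynomial.C (γ (q + ((e + 1 : ℕ) : ZMod n) + s)))).natDegree ≤ k := hprod _
    omega
  · refine (Polynomial.natDegree_mul_le).trans ?_
    have h1 := hlin (c (q - 2, 1, 0)) (c (q - 2, 1, 1))
    have h2 : (∏ s ∈ Finset.range k, (Polynomial.X -
        Polynomial.C (γ (q - 2 + ((e + 1 : ℕ) : ZMod n) + s)))).natDegree ≤ k := hprod _
    omega

/-- **Coefficient extraction**: if `srPoly c q = 0` then the four weights `c (q,0,·)`,
`c (q-2,1,·)` vanish (evaluate at `γ_{q-1}`, `γ_{q-2}`: roots of `R_q`, not of `R_{q-2}`; then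
cancel the nonzero `R_q`).  Needs `γ` injective, `n = e + k + 1`, `2 ≤ k`. [this crux] -/
theorem sr_coeff_eq_zero_of_srPoly_eq_zero [NeZero n] {γ : ZMod n → K}
    (hγ : Function.Injective γ) {e k : ℕ} (hn : n = e + k + 1) (he : 1 ≤ e) (hk : 2 ≤ k)
    (c : ZMod n × Fin 2 × Fin 2 → K) (q : ZMod n) (h0 : srPoly γ e k c q = 0) :
    c (q, 0, 0) = 0 ∧ c (q, 0, 1) = 0 ∧ c (q - 2, 1, 0) = 0 ∧ c (q - 2, 1, 1) = 0 := by
  -- the two products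
  set R1 : Polynomial K := ∏ s ∈ Finset.range k,
    (Polynomial.X - Polynomial.C (γ (q + ((e + 1 : ℕ) : ZMod n) + s))) with hR1
  set R2 : Polynomial K := ∏ s ∈ Finset.range k,
    (Polynomial.X - Polynomial.C (γ (q - 2 + ((e + 1 : ℕ) : ZMod n) + s))) with hR2
  have hpoly : (Polynomial.C (c (q, 0, 0)) * Polynomial.X + Polynomial.C (c (q, 0, 1))) * R1 +
      (Polynomial.C (c (q - 2, 1, 0)) * Polynomial.X + Polynomial.C (c (q - 2, 1, 1))) * R2 = 0 := h0
  -- `R1` vanishes at `γ (q - 1)` (index `s = k - 1`) and at `γ (q - 2)` (index `s = k - 2`)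
  have hR1root : ∀ j : ℕ, 1 ≤ j → j ≤ 2 → R1.eval (γ (q - (j : ZMod n))) = 0 := by
    intro j hj1 hj2; rw [hR1, Polynomial.eval_prod]
    apply Finset.prod_eq_zero (i := k - j) (Finset.mem_range.mpr (by omega))
    simp only [Polynomial.eval_sub, Polynomial.eval_X, Polynomial.eval_C, sub_eq_zero]
    congr 1
    have hcast : ((k - j : ℕ) : ZMod n) = (k : ZMod n) - (j : ZMod n) := Nat.cast_sub (by omega)
    rw [hcast]
    have hn' : ((e + 1 : ℕ) : ZMod n) + (k : ZMod n) = 0 := by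
      rw [← Nat.cast_add, show e + 1 + k = n by omega, ZMod.natCast_self]
    linear_combination -hn'
  -- `R2` does not vanish at `γ (q - 1)`, `γ (q - 2)`
  have hR2ne : ∀ j : ℕ, 1 ≤ j → j ≤ 2 → R2.eval (γ (q - (j : ZMod n))) ≠ 0 := by
    intro j hj1 hj2; rw [hR2, Polynomial.eval_prod]
    refine Finset.prod_ne_zero_iff.mpr fun s hs => ?_
    simp only [Polynomial.eval_sub, Polynomial.eval_X, Polynomial.eval_C, sub_ne_zero]
    intro heq
    have hidx := hγ heq
    -- `q - j = q - 2 + (e+1) + s` forces `n ∣ (e + s + j - 1)` with `0 < e + s + j - 1 < n`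
    have hs' := Finset.mem_range.mp hs
    have hcast : (((e + s + j - 1 : ℕ) : ZMod n)) = 0 := by
      rw [Nat.cast_sub (by omega)]
      push_cast at hidx ⊢
      linear_combination hidx.symm
    rw [ZMod.natCast_eq_zero_iff] at hcast
    have := Nat.le_of_dvd (by omega) hcast
    omega
  -- evaluate the relation at the two points
  have hev : ∀ j : ℕ, 1 ≤ j → j ≤ 2 →
      c (q - 2, 1, 0) * γ (q - (j : ZMod n)) + c (q - 2, 1, 1) = 0 := by
    intro j hj1 hj2
    have := congrArg (Polynomial.eval (γ (q - (j : ZMod n)))) hpoly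
    simp only [Polynomial.eval_add, Polynomial.eval_mul, Polynomial.eval_C, Polynomial.eval_X,
      Polynomial.eval_zero, hR1root j hj1 hj2, mul_zero, zero_add] at this
    exact (mul_eq_zero.mp this).resolve_right (hR2ne j hj1 hj2)
  have h10 : c (q - 2, 1, 0) = 0 := by
    have e1 := hev 1 le_rfl (by norm_num)
    have e2 := hev 2 (by norm_num) le_rfl
    have hsub : c (q - 2, 1, 0) * (γ (q - ((1 : ℕ) : ZMod n)) - γ (q - ((2 : ℕ) : ZMod n))) = 0 := by
      linear_combination e1 - e2
    refine (mul_eq_zero.mp hsub).resolve_right ?_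
    intro heq
    rw [sub_eq_zero] at heq
    have hidx := hγ heq
    have h12 : ((1 : ℕ) : ZMod n) = ((2 : ℕ) : ZMod n) := by linear_combination -hidx
    have : (((2 - 1 : ℕ) : ℕ) : ZMod n) = 0 := by
      rw [Nat.cast_sub (by norm_num), h12, sub_self]
    rw [ZMod.natCast_eq_zero_iff] at this
    have := Nat.le_of_dvd (by norm_num) this
    omega
  have h11 : c (q - 2, 1, 1) = 0 := by
    have e1 := hev 1 le_rfl (by norm_num)
    rw [h10, zero_mul, zero_add] at e1
    exact e1
  -- now `(C c00 X + C c01) * R1 = 0` with `R1 ≠ 0`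
  have hR1ne : R1 ≠ 0 := by
    rw [hR1]
    exact Finset.prod_ne_zero_iff.mpr fun s _ => Polynomial.X_sub_C_ne_zero _
  have hlin : Polynomial.C (c (q, 0, 0)) * Polynomial.X + Polynomial.C (c (q, 0, 1)) = 0 := by
    rw [h10, h11] at hpoly
    simp only [map_zero, zero_mul, add_zero] at hpoly
    exact (mul_eq_zero.mp hpoly).resolve_right hR1ne
  have h00 : c (q, 0, 0) = 0 := by
    simpa using congrArg (Polynomial.coeff · 1) hlin
  have h01 : c (q, 0, 1) = 0 := by
    simpa using congrArg (Polynomial.coeff · 0) hlin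
  exact ⟨h00, h01, h10, h11⟩

end lemmas

/-- **P4-SIMPLE, Right side.**  For injective `α γ : ZMod n → K`, `n = e + k + 1`, `2 ≤ k`:
the `4n` products `P_{q+2o} · y_{2+t} · R_q` span at least `4n - 2(k+2)` dimensions.
[this crux; new] -/
theorem sr_finrank_span_ge {K : Type*} [Field K] {n : ℕ} [NeZero n] {α γ : ZMod n → K}
    (hα : Function.Injective α) (hγ : Function.Injective γ) {e k : ℕ} (hn : n = e + k + 1)
    (he : 1 ≤ e) (hk : 2 ≤ k) :
    4 * n - 2 * (k + 2) ≤ Module.finrank K ↥(Submodule.span K (Set.range (srGen α γ e k))) := by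
  classical
  set Ψ := Fintype.linearCombination K (srGen α γ e k) with hΨ
  have hrange : LinearMap.range Ψ = Submodule.span K (Set.range (srGen α γ e k)) :=
    Fintype.range_linearCombination K _
  -- the recording map on the kernel
  have hke : k + 2 ≤ n := by omega
  let pt : Fin (k + 2) → ZMod n := fun i => ((i : ℕ) : ZMod n)
  have hpt : Function.Injective pt := by
    intro i j hij
    have hi := i.isLt; have hj := j.isLt
    have h1 : (((i : ℕ) : ZMod n)).val = (((j : ℕ) : ZMod n)).val := by
      change (pt i).val = (pt j).val
      rw [hij]
    rw [ZMod.val_natCast, ZMod.val_natCast, Nat.mod_eq_of_lt (by omega),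
      Nat.mod_eq_of_lt (by omega)] at h1
    exact Fin.ext h1
  let Θ : (LinearMap.ker Ψ) →ₗ[K] (Fin (k + 2) × Fin 2 → K) :=
    { toFun := fun c ij => srW γ e k (c : ZMod n × Fin 2 × Fin 2 → K) (pt ij.1 + 1 + ((ij.2 : ℕ) : ZMod n)) (pt ij.1)
      map_add' := by
        intro c d; funext ij
        simp only [Submodule.coe_add, Pi.add_apply]
        exact srW_add γ e k _ _ _ _
      map_smul' := by
        intro r c; funext ij
        simp only [Submodule.coe_smul, Pi.smul_apply, smul_eq_mul, RingHom.id_apply]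
        exact srW_smul γ e k r _ _ _ }
  -- Θ is injective
  have hΘ : Function.Injective Θ := by
    rw [← LinearMap.ker_eq_bot, LinearMap.ker_eq_bot']
    intro c hc
    obtain ⟨c, hcker⟩ := c
    have hrel : Ψ c = 0 := hcker
    -- step 1: for each recorded point v = pt i, all coefficients srW c q v vanish
    have hall : ∀ i : Fin (k + 2), ∀ q : ZMod n, srW γ e k c q (pt i) = 0 := by
      intro i
      have hv : ∑ q : ZMod n, srW γ e k c q (pt i) • swW α (0 : Fin 4) 1 e q = 0 := by
        rw [← srEv_linearCombination α γ e k (pt i) c]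
        change srEv γ (pt i) (Ψ c) = 0
        rw [hrel, map_zero]
      have h01 : (0 : Fin 4) ≠ 1 := by decide
      have hzero := sw_coeff_eq_zero_of_sum_eq_zero_of_top_two hα h01 (e := e) (by omega)
        (pt i - (e : ZMod n)) (fun q => srW γ e k c q (pt i))
        (fun q hq => srW_support γ hn c (pt i) q hq) hv ?_ ?_
      · intro q; exact congrFun hzero q
      · have := congrFun hc (i, 0)
        simp only [Θ, LinearMap.coe_mk, AddHom.coe_mk, Pi.zero_apply] at this
        convert this using 2
        simp only [Fin.val_zero, Nat.cast_zero, Nat.cast_add, Nat.cast_one]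
        ring
      · have := congrFun hc (i, 1)
        simp only [Θ, LinearMap.coe_mk, AddHom.coe_mk, Pi.zero_apply] at this
        convert this using 2
        simp only [Fin.val_one, Nat.cast_one, Nat.cast_add, Nat.cast_ofNat]
        ring
    -- step 2: each srPoly c q vanishes at k+2 distinct points, hence is zero
    have hpoly : ∀ q : ZMod n, srPoly γ e k c q = 0 := by
      intro q
      refine Polynomial.eq_zero_of_natDegree_lt_card_of_eval_eq_zero _ (hγ.comp hpt)
        (fun i => ?_) ?_
      · rw [Function.comp_apply, eval_srPoly]; exact hall i q
      · simp only [Fintype.card_fin]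
        exact Nat.lt_succ_of_le (natDegree_srPoly_le γ e k c q)
    -- step 3: all weights vanish
    apply Subtype.ext
    funext ⟨q, o, t⟩
    simp only [Submodule.coe_zero, Pi.zero_apply]
    fin_cases o
    · have h := sr_coeff_eq_zero_of_srPoly_eq_zero hγ hn he hk c q (hpoly q)
      fin_cases t
      · exact h.1
      · exact h.2.1
    · have h := sr_coeff_eq_zero_of_srPoly_eq_zero hγ hn he hk c (q + 2) (hpoly (q + 2))
      simp only [add_sub_cancel_right] at h
      fin_cases t
      · exact h.2.2.1
      · exact h.2.2.2
  -- dimension count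
  have hker : Module.finrank K (LinearMap.ker Ψ) ≤ 2 * (k + 2) := by
    have := LinearMap.finrank_le_finrank_of_injective hΘ
    rw [Module.finrank_fintype_fun_eq_card, Fintype.card_prod, Fintype.card_fin,
      Fintype.card_fin] at this
    linarith
  have hrn := LinearMap.finrank_range_add_finrank_ker Ψ
  rw [Module.finrank_fintype_fun_eq_card, Fintype.card_prod, Fintype.card_prod, ZMod.card,
    Fintype.card_fin] at hrn
  rw [← hrange]
  omega

end

end Summit.ValiantsHypothesis.ValiantsHypothesis.Theorems.ValuativeFlip
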